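import Summits.CriticalPhenomena.PercolationContinuityZ3.Theorems.Transplant.BoxProdZ2Excess
import Summits.CriticalPhenomena.PercolationContinuityZ3.Theorems.Transplant.KNLevelsEntrance
import Literature.Probability.Percolation.KozmaNitzanHittable
import HarnessLib

/-!
# The EXCESS DISCHARGE of a concentric tube chain (design (D), §11 v2): `P_W(⋃_{t ∈ Rim} {root ↔ t}) ≤ η` for the rim part of an enlarged
# target, from (i) the entrance reduction (`KNLevels.real_biUnion_openConn_le_linkIn`: every positive-weight entrance into the habitat `D`
# is fibre-deep, radius `≤ R₀'`), (ii) the collar event `excess` (the rim lies beyond fibre radius `R - L'`), (iii) the subbox transfer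
# `real_excess_eq`, (iv) `exists_excess_radius` / `excess_le_of_frame` at the RUNNING parameter (centre `w₀`, representatives `{w₀}`,
# frame `refl`) — the `hexc` hypothesis of p2-g2's `hreach_of_tubeChain` / `cond_of_tubeStep` / `hQ0_of_chain_sub` / `lt_real_of_advChain`

builds on p205010 (kernel theorem, internal audit signed; external expert review pending) — nothing in this file uses p205010.
Lane `prim-bschramm`, seat `prim-bschramm-p3` (order I2 of V56); helper file (`--supports stmt-CriticalPhenomena-4575 --as helper`).

* **`real_rim_le_excess`** — `P_W(⋃_{t ∈ Rim} root ↔ t) ≤ P_q(excess w₀ (R - L') D A)` with `A := {v ∈ D | v.1 ∈ B(w₀, R₀')}`, for a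
  weighting vanishing off the edges, `D` a subbox of the tube graph over `π ⊇ fibres of D`, `root ∉ D`, `Rim ⊆ D` beyond radius `R - L'`,
  and every positive-weight entrance into `D` landing at fibre radius `≤ R₀'`;
* **`real_rim_le_of_radius`** — hence `≤ η` once `R - L' ≥ R₁(η)` for the excess radius `R₁` of `exists_excess_radius X hT {w₀} R₀' n η`
  (stated with the radius bound as the hypothesis `hR₁` in the shape `excess_le_of_frame` consumes) and `D ⊆ B(w₀, Rw) × (v + Λ_n)`;
* §2 **`real_rim_le_of_wired_source`** — the rim excess of a chain from a WIRED source set under the law cut to its world (the inner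
  elongated routes): no entrance analysis, the source set is the near set of the collar event around the contact's centre.
[cite: KozmaNitzan2024, §4 Lemma 12 (p. 24: the faces on the boundary of the slab)] [cite: MartineauSevero2019, Cor. 2.2]
-/

noncomputable section

open MeasureTheory

namespace Summit.CriticalPhenomena.PercolationContinuityZ3.Theorems

namespace Transplant

namespace BoxProdZ2

open Literature.Probability.Percolation Literature.Probability.LatticeModels SimpleGraph KNLevels
open Literature.Barriers.CriticalPhenomena (graphBall graphBall_finite mem_graphBall_self graphBall_mono mem_graphBall_map)

variable {W : Type} [DecidableEq W] (X : SimpleGraph W) [X.LocallyFinite]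

/-- **Rim excess ≤ collar probability.**  For a weighting `Wt` vanishing off the edges of `X □ ℤ²` that is a subbox of the tube graph over
`π` on `D` (fibres of `D` in `π`), a source `root ∉ D`, a rim `Rim ⊆ D` beyond fibre radius `R - L'` from `w₀`, and entrances of positive
weight landing at fibre radius `≤ R₀'`: `P_{Wt}(⋃_{t ∈ Rim} root ↔ t) ≤ P_q(excess w₀ (R - L') D {v ∈ D | v.1 ∈ B(w₀, R₀')})`.
[cite: KozmaNitzan2024, §4 Lemma 12 (p. 24)] -/
theorem real_rim_le_excess [Countable W] {π : Finset W} {Wt : Sym2 (W × Site 2) → unitInterval} {q : unitInterval}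
    {D : Finset (W × Site 2)} (hWD : IsSubbox (tubeGraph X π) Wt q D) (hDπ : ∀ v ∈ D, v.1 ∈ π)
    (hWG : ∀ e, e ∉ (X □ zdGraph 2).edgeSet → Wt e = 0) {root : W × Site 2} (hroot : root ∉ D)
    {w₀ : W} {R L' R₀' : ℕ} {Rim : Finset (W × Site 2)} (hRimD : Rim ⊆ D) (hRimfar : ∀ t ∈ Rim, t.1 ∉ ballFin X w₀ (R - L'))
    (hA : ∀ a b, a ∉ D → b ∈ D → (X □ zdGraph 2).Adj a b → Wt s(a, b) ≠ 0 → b.1 ∈ ballFin X w₀ R₀') :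
    (prodBernoulli Wt).real (⋃ t ∈ Rim, openConn root t) ≤
      (bondPercolation (X □ zdGraph 2) q).real (excess X w₀ (R - L') D (D.filter fun v => v.1 ∈ ballFin X w₀ R₀')) := by
  set A := D.filter fun v => v.1 ∈ ballFin X w₀ R₀' with hAdef
  -- entrances
  have h1 := real_biUnion_openConn_le_linkIn (G := X □ zdGraph 2) hWG hRimD hroot (A := A)
    (fun a b ha hb hab hw => Finset.mem_filter.2 ⟨hb, hA a b ha hb hab hw⟩)
  -- the rim lies in the far set
  have h2 : linkIn (↑D : Set (W × Site 2)) A Rim ⊆ excess X w₀ (R - L') D A := by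
    rw [excess]
    exact linkIn_mono le_rfl le_rfl fun t ht => Finset.mem_filter.2 ⟨hRimD ht, hRimfar t ht⟩
  calc (prodBernoulli Wt).real (⋃ t ∈ Rim, openConn root t)
      ≤ (prodBernoulli Wt).real (linkIn (↑D : Set (W × Site 2)) A Rim) := h1
    _ ≤ (prodBernoulli Wt).real (excess X w₀ (R - L') D A) := measureReal_mono h2 (measure_ne_top _ _)
    _ = (bondPercolation (X □ zdGraph 2) q).real (excess X w₀ (R - L') D A) := real_excess_eq X hWD hDπ w₀ (R - L') A

/-- **Rim excess ≤ η** from an excess radius at the running parameter: with `hR₁` the conclusion of `exists_excess_radius X hT {w₀} R₀' n η`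
(at `q`), `R₁ ≤ R - L'`, and `D ⊆ B(w₀, Rw) × (v + Λ_n)`. [cite: KozmaNitzan2024, §4 Lemma 12 (p. 24)] [cite: MartineauSevero2019, Cor. 2.2] -/
theorem real_rim_le_of_radius [Countable W] {π : Finset W} {Wt : Sym2 (W × Site 2) → unitInterval} {q : unitInterval}
    {D : Finset (W × Site 2)} (hWD : IsSubbox (tubeGraph X π) Wt q D) (hDπ : ∀ v ∈ D, v.1 ∈ π)
    (hWG : ∀ e, e ∉ (X □ zdGraph 2).edgeSet → Wt e = 0) {root : W × Site 2} (hroot : root ∉ D)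
    {w₀ : W} {R L' R₀' : ℕ} {Rim : Finset (W × Site 2)} (hRimD : Rim ⊆ D) (hRimfar : ∀ t ∈ Rim, t.1 ∉ ballFin X w₀ (R - L'))
    (hA : ∀ a b, a ∉ D → b ∈ D → (X □ zdGraph 2).Adj a b → Wt s(a, b) ≠ 0 → b.1 ∈ ballFin X w₀ R₀')
    {n : ℕ} {η : ℝ} {R₁ : ℕ}
    (hR₁ : ∀ R', R₁ ≤ R' → ∀ τ ∈ ({w₀} : Finset W), ∀ (Rw : ℕ) (D' A' : Finset (W × Site 2)), D' ⊆ ballFin X τ Rw ×ˢ box 2 n → A' ⊆ D' →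
      (∀ a ∈ A', a.1 ∈ ballFin X τ R₀') → (bondPercolation (X □ zdGraph 2) q).real (excess X τ R' D' A') ≤ η)
    (hR : R₁ ≤ R - L') {Rw : ℕ} {v : Site 2} (hD : D ⊆ ballFin X w₀ Rw ×ˢ (box 2 n).image (fun s => s + v)) :
    (prodBernoulli Wt).real (⋃ t ∈ Rim, openConn root t) ≤ η := by
  refine (real_rim_le_excess X hWD hDπ hWG hroot hRimD hRimfar hA).trans ?_
  exact excess_le_of_frame X {w₀} R₀' n hR₁ hR (SimpleGraph.Iso.refl (G := X)) (by simp) v hD (Finset.filter_subset _ _)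
    (fun a ha => (Finset.mem_filter.1 ha).2)

/-! ## §2 The rim excess of a chain from a WIRED SOURCE SET (the inner elongated routes)

The inner straight run of a face-step route runs under `restrW Qt (pinW Wt F₀ pat)` — the kit prism `S` wired (`F₀ ⊆ wireSet S`), the law cut to
the route world `Qt` — from the point source `o ∈ S`.  Its rim excess needs no entrance analysis: the source set itself is the near set of
the collar event around the contact's centre `c` (frame `γ c ∈ V₀`). -/

/-- **Rim excess from a wired source set.**  For a subbox `Qt` of `Wt` in the tube graph over `π` (fibres of `Qt` in `π`), a source set
`S ⊆ Qt` with fibres in `B(c, R₀')`, a point `o ∈ S`, a rim `Rim ⊆ Qt` disjoint from `S` with fibres outside `B(c, r₁)`, an excess radius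
`R₁ ≤ r₁` at the running parameter over the representatives `V₀`, a frame `γ c ∈ V₀` and `Qt ⊆ B(c, Rw) × (v + Λ_n)`: under the law cut to
`Qt` with any pinning of pairs inside `S`, `P(⋃_{t ∈ Rim} o ↔ t) ≤ η`. [cite: KozmaNitzan2024, §4 Lemma 11 (p. 22), Lemma 12 (p. 24)]
[cite: MartineauSevero2019, Cor. 2.2] -/
theorem real_rim_le_of_wired_source [Countable W] {π : Finset W} {Wt : Sym2 (W × Site 2) → unitInterval} {q : unitInterval}
    {Qt : Finset (W × Site 2)} (hWQ : IsSubbox (tubeGraph X π) Wt q Qt) (hQπ : ∀ v ∈ Qt, v.1 ∈ π)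
    {S Rim : Finset (W × Site 2)} (hSQ : S ⊆ Qt) (hRimQ : Rim ⊆ Qt) (hSR : Disjoint S Rim) {o : W × Site 2} (ho : o ∈ S)
    {c : W} {r₁ R₀' : ℕ} (hfar : ∀ t ∈ Rim, t.1 ∉ ballFin X c r₁) (hnear : ∀ s ∈ S, s.1 ∈ ballFin X c R₀')
    (V₀ : Finset W) {n : ℕ} {η : ℝ} {R₁ : ℕ}
    (hR₁ : ∀ R', R₁ ≤ R' → ∀ τ ∈ V₀, ∀ (Rw : ℕ) (D' A' : Finset (W × Site 2)), D' ⊆ ballFin X τ Rw ×ˢ box 2 n → A' ⊆ D' →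
      (∀ a ∈ A', a.1 ∈ ballFin X τ R₀') → (bondPercolation (X □ zdGraph 2) q).real (excess X τ R' D' A') ≤ η)
    (hR : R₁ ≤ r₁) (γ : X ≃g X) (hγ : γ c ∈ V₀) {Rw : ℕ} {v : Site 2} (hQt : Qt ⊆ ballFin X c Rw ×ˢ (box 2 n).image (fun s => s + v))
    {F₀ : Set (Sym2 (W × Site 2))} (hF₀ : F₀ ⊆ wireSet (↑S : Set (W × Site 2))) (pat : Set (Sym2 (W × Site 2))) :
    (prodBernoulli (restrW (↑Qt : Set (W × Site 2)) (pinW Wt F₀ pat))).real (⋃ t ∈ Rim, openConn o t) ≤ η := by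
  -- under the cut law open paths stay inside `Qt`
  have h1 : (prodBernoulli (restrW (↑Qt : Set (W × Site 2)) (pinW Wt F₀ pat))).real (⋃ t ∈ Rim, openConn o t) =
      (prodBernoulli (pinW Wt F₀ pat)).real (⋃ t ∈ (↑Rim : Set (W × Site 2)), openConnIn (↑Qt : Set (W × Site 2)) o t) := by
    rw [← prodBernoulli_restrW_real_biUnion_openConn (pinW Wt F₀ pat) (↑Qt : Set (W × Site 2)) (Finset.mem_coe.2 (hSQ ho))]
    simp only [Finset.mem_coe]
  -- a connection from `o ∈ S` inside `Qt` is a link from `S`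
  have h2 : (⋃ t ∈ (↑Rim : Set (W × Site 2)), openConnIn (↑Qt : Set (W × Site 2)) o t) ⊆ linkIn (↑Qt : Set (W × Site 2)) S Rim := by
    intro ω hω
    simp only [Set.mem_iUnion, exists_prop, Finset.mem_coe] at hω
    obtain ⟨t, ht, hot⟩ := hω
    exact mem_linkIn_iff.2 ⟨o, ho, t, ht, hot⟩
  -- wiring the source does not change the link probability; the rim is far from `c`
  have h3 : linkIn (↑Qt : Set (W × Site 2)) S Rim ⊆ excess X c r₁ Qt S := by
    rw [excess]; exact linkIn_mono le_rfl le_rfl fun t ht => Finset.mem_filter.2 ⟨hRimQ ht, hfar t ht⟩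
  calc (prodBernoulli (restrW (↑Qt : Set (W × Site 2)) (pinW Wt F₀ pat))).real (⋃ t ∈ Rim, openConn o t)
      = (prodBernoulli (pinW Wt F₀ pat)).real (⋃ t ∈ (↑Rim : Set (W × Site 2)), openConnIn (↑Qt : Set (W × Site 2)) o t) := h1
    _ ≤ (prodBernoulli (pinW Wt F₀ pat)).real (linkIn (↑Qt : Set (W × Site 2)) S Rim) := measureReal_mono h2 (measure_ne_top _ _)
    _ = (prodBernoulli Wt).real (linkIn (↑Qt : Set (W × Site 2)) S Rim) := (real_linkIn_eq_pinW_source Wt Qt hSR hF₀ pat).symm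
    _ ≤ (prodBernoulli Wt).real (excess X c r₁ Qt S) := measureReal_mono h3 (measure_ne_top _ _)
    _ = (bondPercolation (X □ zdGraph 2) q).real (excess X c r₁ Qt S) := real_excess_eq X hWQ hQπ c r₁ S
    _ ≤ η := excess_le_of_frame X V₀ R₀' n hR₁ hR γ hγ v hQt hSQ hnear

end BoxProdZ2

end Transplant

end Summit.CriticalPhenomena.PercolationContinuityZ3.Theorems

end
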